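import Mathlib
import Summits.NavierStokesRegularity.OSWSelfSimilar.HouLuoOriginLaws
import HarnessLib

/-!
# Viscous gCLM/OSW profile MODEL: the HALF-LINE identity and the ENERGY identity of the frozen-`ε` sheet map,
# and the SIGN LAWS they force on one-signed profiles

HONEST FRAMING (cell ns-blowup GROUP B «PROFILE SEARCH», zone Z3 = the 1-D viscous gCLM/OSW sheet; human rulings
D-0035/D-0074): **1-D MODEL; one-variable calculus kernel-checked; not Euler, not Navier–Stokes; «violates: none — MODEL».**
Nothing in this file is a statement about Navier–Stokes.

OBJECT. The frozen-`ε` profile («sheet») map of the viscous generalised Constantin–Lax–Majda / Okamoto–Sakajo–Wunsch model in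
the cell's gauge (HOME/profile/z3/SHEET.md §1.2; engines `z3e.py`, `z3core.py`):

  `G(Ω; c_ω, c_l, a, ε)(ξ) = c_ω Ω + c_l ξ Ω′ + a 𝒰 Ω′ − (HΩ) Ω − ε Ω″`,  `𝒰′ = HΩ`, `𝒰(0) = 0`, `Ω` odd,

which is `HouLuoOriginLaws.F1 c_ω c_l a b ε H U Ω Ω′ Ω″ P` of this directory with stretching coefficient `b = 1` and no
temperature forcing `P = 0` (we keep `b` and `P` symbolic in the identities — they cost nothing — and specialise in the sign laws).
Blow-up is `c_ω > 0` (time gauge of record `c_ω = 1`); the collapse part of the sheet is `c_l > 0`; the NS-type line (constant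
viscosity, `Literature.Analysis.FluidPDE.effectiveViscosity_half`) is `c_l = c_ω/2`; the CLM point `a = 0` sits at `c_l = c_ω`.
As in `HouLuoOriginLaws` / `HouLuoViscousThetaFloor`, `H = HΩ` and `U = 𝒰` are ARBITRARY real functions tied only by `𝒰′ = H`:
every statement below is pure calculus on the half-line / line; the one genuinely nonlocal input — the SIGN of the half-line
stretching pairing `∫₀^∞ (HΩ)·Ω ≤ 0` for odd `Ω` when `H` is the Hilbert transform (Carleman form
`∫₀^∞ (HΩ)Ω = −π⁻¹ ∫₀^∞∫₀^∞ Ω(x)Ω(y)/(x+y) dx dy = −π⁻¹∫₀^∞ |𝓛Ω(s)|² ds`) — enters the sign laws as the explicit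
hypothesis `hpair`, to be discharged for `H = hilbertTransform Ω` in a companion file.

WHAT IS KERNEL-CHECKED HERE.
* `halfLine_identity` — **THE HALF-LINE IDENTITY** (test `G` against `𝟙_{ξ>0}`; the third exact null of the sheet after the
  origin law `SheetROriginLaw.origin_law_viscousGCLM` and the energy identity): for a `C²` profile with `Ω(0) = 0` solving
  `F1 ≡ 0` on `(0, ∞)`, in the decay class «`Ω, (HΩ)Ω, ξΩ′, 𝒰Ω′, Ω″, P ∈ L¹(0,∞)`, `ξΩ → 0`, `𝒰Ω → 0`, `Ω′ → 0` at `+∞`»,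
    `(c_ω − c_l) ∫₀^∞ Ω − (a + b) ∫₀^∞ (HΩ) Ω − ∫₀^∞ P + ε Ω′(0) = 0`.                                    (★)
  The decay class is that of the algebraic tail `Ω ~ A ξ^{−c_ω/c_l}` for `c_l < c_ω` (SHEET §1.5) — it contains the NS-type
  line `c_l = c_ω/2` (`Ω ~ Aξ⁻²`) and excludes the CLM point `c_l = c_ω` (`Ω ~ ξ⁻¹`, `[ξΩ]₀^∞ ≠ 0`). PEN CHECKS (not kernel):
  Chen 2020's exact inviscid profile (`a = ½`, `c_l = ⅓`, `Ω = −(16/3)ξ/(1+ξ²)²`): `(2/3)(−8/3) + (3/2)(32/27) = 0`; on the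
  kernel exact row `c_l = ⅓` (`SheetRowThirdExactFamily`) (★) REPRODUCES the width law `w² = 9εa/(1−2a)`.
* `energy_identity` — **THE ENERGY IDENTITY** (test `G` against `Ω` on `ℝ`; SHEET §1.6, engine null to 1e-15…1e-7 on E½):
    `(c_ω − c_l/2) ∫ Ω² − (b + a/2) ∫ (HΩ) Ω² − ∫ P Ω + ε ∫ Ω′² = 0`.                                     (E)
* SIGN LAWS on the collapse sheet `{c_l < c_ω}` (any `ε ≥ 0`, `b = 1`, `P = 0`), modulo `hpair : ∫₀^∞ (HΩ)Ω ≤ 0`: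
  `trivial_of_nonneg_on_Ioi` — if `a ≥ −1`, a profile with `Ω ≥ 0` on `(0,∞)` vanishes on `(0,∞)`;
  `trivial_of_nonpos_on_Ioi` — if `a ≤ −1`, a profile with `Ω ≤ 0` on `(0,∞)` (the sign class of E½ and of every known
  blow-up profile of the model) vanishes on `(0,∞)`; so at `a = −1` (Córdoba–Córdoba–Fontelos) no one-signed profile exists, and
  for `a ≤ −1` the E½ sign class is EMPTY on the whole collapse sheet — the steady, every-`ε` shadow of the printed PDE facts
  «`a ≤ −1`: global well-posedness with `Λ^γ`, `γ ∈ [|a|⁻¹, 2]`» (Chen 2020 Thm 1.5) and «odd data with `ω₀ ≥ 0` on `x > 0` are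
  global» (Chen 2020 Thm 1.3, his operators `𝓛_m`), cited not restated (`Literature.Analysis.FluidPDE.Chen2020DissipativeGCLM`).
* `trivial_of_a_eq_neg_two` — from (E) alone: at `a = −2`, `b = 1`, `P = 0`, `ε ≥ 0` the sheet `{c_l < 2c_ω}` is EMPTY.
NOT PROVED HERE: anything for `−1 < a < 0` beyond the sign law (the cell's «NONE FOUND» there, CENSUS-Z3 row Z3-E12⁻, stays a
search word — (★), (E), the origin law and `HouLuoViscousThetaFloor.comega_le_stretching_of_isLocalMax` are all satisfiable
there); the sign `hpair` itself (companion file); existence of anything; anything about Euler or NS.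
bears_on: LADDER-NS N5 / zone Z3 clause (i′) (CENSUS-Z3 v2.2 §0) → N1 linear core; SELFSIM-NOGO M7/M8 MODEL side.
-/

noncomputable section
open Set Filter Topology MeasureTheory

namespace Summit.NavierStokesRegularity.OSWSelfSimilar
namespace SheetHalfLine
open HouLuoOriginLaws (F1)

/-! ### Two calculus lemmas -/

/-- A function with `f(0) = 0`, `f ≥ 0` on `(0,∞)` and a derivative `f′(0)` at `0` has `f′(0) ≥ 0`
(the right difference quotients are `≥ 0`). [folklore] -/
theorem deriv_nonneg_of_nonneg_on_Ioi {f : ℝ → ℝ} {f' : ℝ} (hf : HasDerivAt f f' 0) (h0 : f 0 = 0)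
    (hpos : ∀ x ∈ Ioi (0:ℝ), 0 ≤ f x) : 0 ≤ f' := by
  have ht : Tendsto (slope f 0) (𝓝[≠] 0) (𝓝 f') := hasDerivAt_iff_tendsto_slope.mp hf
  have hsub : Ioi (0:ℝ) ⊆ {0}ᶜ := fun x hx => by
    simp only [mem_compl_iff, mem_singleton_iff]
    exact ne_of_gt hx
  have ht' : Tendsto (slope f 0) (𝓝[>] 0) (𝓝 f') := ht.mono_left (nhdsWithin_mono _ hsub)
  refine ge_of_tendsto ht' ?_
  filter_upwards [self_mem_nhdsWithin] with t ht
  rw [slope_def_field, h0, sub_zero, sub_zero]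
  exact div_nonneg (hpos t ht) (le_of_lt ht)

/-- A function continuous and `≥ 0` on `(0,∞)` whose integral over `(0,∞)` vanishes (and which is integrable there)
vanishes on `(0,∞)`. [folklore] -/
theorem eqOn_zero_of_nonneg_of_integral_eq_zero {f : ℝ → ℝ} (hc : ContinuousOn f (Ioi 0))
    (hpos : ∀ x ∈ Ioi (0:ℝ), 0 ≤ f x) (hi : IntegrableOn f (Ioi 0)) (hint : ∫ x in Ioi (0:ℝ), f x = 0) :
    EqOn f 0 (Ioi 0) := by
  have hae : 0 ≤ᵐ[volume.restrict (Ioi (0:ℝ))] f :=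
    (ae_restrict_iff' measurableSet_Ioi).mpr (Eventually.of_forall hpos)
  have hz : f =ᵐ[volume.restrict (Ioi (0:ℝ))] 0 := (setIntegral_eq_zero_iff_of_nonneg_ae hae hi).mp hint
  exact Measure.eqOn_open_of_ae_eq hz isOpen_Ioi hc continuousOn_const

/-! ### The half-line identity -/

/-- **THE HALF-LINE IDENTITY (★) of the frozen-`ε` gCLM/OSW sheet map** (explicit-hypothesis form). Let `Ω` be `C²` on `ℝ`
(`Ω′ = dOm`, `Ω″ = ddOm`), `Ω(0) = 0`, `𝒰′ = H` everywhere, and `F₁ ≡ 0` on `(0,∞)` (stretching coefficient `b`, forcing `P`).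
If `Ω, (H)Ω, ξΩ′, 𝒰Ω′, Ω″, P` are integrable on `(0,∞)` and `ξΩ(ξ) → 0`, `𝒰(ξ)Ω(ξ) → 0`, `Ω′(ξ) → 0` as `ξ → +∞`, then
`(c_ω − c_l)∫₀^∞ Ω − (a + b)∫₀^∞ HΩ·Ω − ∫₀^∞ P + ε Ω′(0) = 0`. [new here — MODEL] -/
theorem halfLine_identity (cω cl a b ε : ℝ) (H U Om dOm ddOm P : ℝ → ℝ)
    (hU : ∀ ξ, HasDerivAt U (H ξ) ξ) (hOm : ∀ ξ, HasDerivAt Om (dOm ξ) ξ) (hdOm : ∀ ξ, HasDerivAt dOm (ddOm ξ) ξ)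
    (hOm0 : Om 0 = 0) (hF : ∀ ξ ∈ Ioi (0:ℝ), F1 cω cl a b ε H U Om dOm ddOm P ξ = 0)
    (iOm : IntegrableOn Om (Ioi 0)) (iHOm : IntegrableOn (fun ξ => H ξ * Om ξ) (Ioi 0))
    (iξd : IntegrableOn (fun ξ => ξ * dOm ξ) (Ioi 0)) (iUd : IntegrableOn (fun ξ => U ξ * dOm ξ) (Ioi 0))
    (idd : IntegrableOn ddOm (Ioi 0)) (iP : IntegrableOn P (Ioi 0))
    (hξOm : Tendsto (fun ξ => ξ * Om ξ) atTop (𝓝 0)) (hUOm : Tendsto (fun ξ => U ξ * Om ξ) atTop (𝓝 0))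
    (hdOmInf : Tendsto dOm atTop (𝓝 0)) :
    (cω - cl) * (∫ ξ in Ioi (0:ℝ), Om ξ) - (a + b) * (∫ ξ in Ioi (0:ℝ), H ξ * Om ξ) - (∫ ξ in Ioi (0:ℝ), P ξ)
      + ε * dOm 0 = 0 := by
  -- (i) ∫₀^∞ (Ω + ξΩ′) = 0
  have h1 : ∫ ξ in Ioi (0:ℝ), (Om ξ + ξ * dOm ξ) = 0 := by
    have hd : ∀ ξ ∈ Ioi (0:ℝ), HasDerivAt (fun x => x * Om x) (Om ξ + ξ * dOm ξ) ξ := by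
      intro ξ _
      have h := (hasDerivAt_id' ξ).mul (hOm ξ)
      refine h.congr_deriv ?_
      ring
    have hc : ContinuousWithinAt (fun x : ℝ => x * Om x) (Ici 0) 0 :=
      ((hasDerivAt_id' (0:ℝ)).mul (hOm 0)).continuousAt.continuousWithinAt
    have hi : IntegrableOn (fun ξ => Om ξ + ξ * dOm ξ) (Ioi (0:ℝ)) := iOm.add iξd
    have h := integral_Ioi_of_hasDerivAt_of_tendsto hc hd hi hξOm
    simpa using h
  -- (ii) ∫₀^∞ (HΩ·Ω + 𝒰Ω′) = 0
  have h2 : ∫ ξ in Ioi (0:ℝ), (H ξ * Om ξ + U ξ * dOm ξ) = 0 := by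
    have hd : ∀ ξ ∈ Ioi (0:ℝ), HasDerivAt (fun x => U x * Om x) (H ξ * Om ξ + U ξ * dOm ξ) ξ :=
      fun ξ _ => (hU ξ).mul (hOm ξ)
    have hc : ContinuousWithinAt (fun x : ℝ => U x * Om x) (Ici 0) 0 :=
      ((hU 0).mul (hOm 0)).continuousAt.continuousWithinAt
    have hi : IntegrableOn (fun ξ => H ξ * Om ξ + U ξ * dOm ξ) (Ioi (0:ℝ)) := iHOm.add iUd
    have h := integral_Ioi_of_hasDerivAt_of_tendsto hc hd hi hUOm
    simpa [hOm0] using h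
  -- (iii) ∫₀^∞ Ω″ = −Ω′(0)
  have h3 : ∫ ξ in Ioi (0:ℝ), ddOm ξ = 0 - dOm 0 := by
    have hc : ContinuousWithinAt dOm (Ici 0) 0 := (hdOm 0).continuousAt.continuousWithinAt
    exact integral_Ioi_of_hasDerivAt_of_tendsto hc (fun ξ _ => hdOm ξ) idd hdOmInf
  -- integrate F₁ ≡ 0 over (0,∞) after regrouping
  have key : ∫ ξ in Ioi (0:ℝ), F1 cω cl a b ε H U Om dOm ddOm P ξ = 0 := by
    have hcongr : EqOn (F1 cω cl a b ε H U Om dOm ddOm P) (fun _ => 0) (Ioi 0) := fun ξ hξ => hF ξ hξ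
    rw [setIntegral_congr_fun measurableSet_Ioi hcongr]
    simp
  have hre : ∀ ξ, F1 cω cl a b ε H U Om dOm ddOm P ξ =
      ((cω - cl) * Om ξ + cl * (Om ξ + ξ * dOm ξ) + a * (H ξ * Om ξ + U ξ * dOm ξ))
        - ((a + b) * (H ξ * Om ξ) + P ξ + ε * ddOm ξ) := by
    intro ξ
    unfold HouLuoOriginLaws.F1
    ring
  have iA1 : Integrable (fun ξ => (cω - cl) * Om ξ) (volume.restrict (Ioi (0:ℝ))) := iOm.const_mul _
  have iA2 : Integrable (fun ξ => cl * (Om ξ + ξ * dOm ξ)) (volume.restrict (Ioi (0:ℝ))) := (iOm.add iξd).const_mul _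
  have iA3 : Integrable (fun ξ => a * (H ξ * Om ξ + U ξ * dOm ξ)) (volume.restrict (Ioi (0:ℝ))) :=
    (iHOm.add iUd).const_mul _
  have iA12 : Integrable (fun ξ => (cω - cl) * Om ξ + cl * (Om ξ + ξ * dOm ξ)) (volume.restrict (Ioi (0:ℝ))) :=
    iA1.add iA2
  have iA : Integrable (fun ξ => (cω - cl) * Om ξ + cl * (Om ξ + ξ * dOm ξ) + a * (H ξ * Om ξ + U ξ * dOm ξ))
      (volume.restrict (Ioi (0:ℝ))) := iA12.add iA3
  have iB1 : Integrable (fun ξ => (a + b) * (H ξ * Om ξ)) (volume.restrict (Ioi (0:ℝ))) := iHOm.const_mul _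
  have iB3 : Integrable (fun ξ => ε * ddOm ξ) (volume.restrict (Ioi (0:ℝ))) := idd.const_mul _
  have iB12 : Integrable (fun ξ => (a + b) * (H ξ * Om ξ) + P ξ) (volume.restrict (Ioi (0:ℝ))) := iB1.add iP
  have iB : Integrable (fun ξ => (a + b) * (H ξ * Om ξ) + P ξ + ε * ddOm ξ) (volume.restrict (Ioi (0:ℝ))) :=
    iB12.add iB3
  simp_rw [hre] at key
  rw [integral_sub iA iB, integral_add iA12 iA3, integral_add iA1 iA2, integral_add iB12 iB3, integral_add iB1 iP,
    integral_const_mul, integral_const_mul, integral_const_mul, integral_const_mul, integral_const_mul, h1, h2, h3] at key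
  linear_combination key

/-- (★) for the gCLM/OSW sheet proper (`b = 1`, `P = 0`): `(c_ω − c_l)∫₀^∞ Ω − (1 + a)∫₀^∞ HΩ·Ω + ε Ω′(0) = 0`.
[new here — MODEL] -/
theorem halfLine_identity_gCLM (cω cl a ε : ℝ) (H U Om dOm ddOm : ℝ → ℝ)
    (hU : ∀ ξ, HasDerivAt U (H ξ) ξ) (hOm : ∀ ξ, HasDerivAt Om (dOm ξ) ξ) (hdOm : ∀ ξ, HasDerivAt dOm (ddOm ξ) ξ)
    (hOm0 : Om 0 = 0) (hF : ∀ ξ ∈ Ioi (0:ℝ), F1 cω cl a 1 ε H U Om dOm ddOm (fun _ => 0) ξ = 0)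
    (iOm : IntegrableOn Om (Ioi 0)) (iHOm : IntegrableOn (fun ξ => H ξ * Om ξ) (Ioi 0))
    (iξd : IntegrableOn (fun ξ => ξ * dOm ξ) (Ioi 0)) (iUd : IntegrableOn (fun ξ => U ξ * dOm ξ) (Ioi 0))
    (idd : IntegrableOn ddOm (Ioi 0))
    (hξOm : Tendsto (fun ξ => ξ * Om ξ) atTop (𝓝 0)) (hUOm : Tendsto (fun ξ => U ξ * Om ξ) atTop (𝓝 0))
    (hdOmInf : Tendsto dOm atTop (𝓝 0)) :
    (cω - cl) * (∫ ξ in Ioi (0:ℝ), Om ξ) - (1 + a) * (∫ ξ in Ioi (0:ℝ), H ξ * Om ξ) + ε * dOm 0 = 0 := by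
  have h := halfLine_identity cω cl a 1 ε H U Om dOm ddOm (fun _ => 0) hU hOm hdOm hOm0 hF iOm iHOm iξd iUd idd
    integrableOn_zero hξOm hUOm hdOmInf
  simp only [integral_zero, sub_zero] at h
  linear_combination h

/-! ### The sign laws (modulo the pairing sign `∫₀^∞ HΩ·Ω ≤ 0`) -/

/-- **SIGN LAW 1: for `a ≥ −1` no blow-up profile is `≥ 0` on `(0,∞)`.** On the collapse sheet `c_l < c_ω` with `ε ≥ 0`,
a `C²` solution of the gCLM/OSW sheet equation on `(0,∞)` in the decay class of `halfLine_identity_gCLM`, with `Ω(0) = 0`,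
`Ω ≥ 0` on `(0,∞)` and half-line stretching pairing `∫₀^∞ HΩ·Ω ≤ 0` (true for the Hilbert transform of an odd `Ω`,
companion file), vanishes on `(0,∞)`: in (★) every term `(c_ω − c_l)∫₀^∞Ω`, `−(1+a)∫₀^∞HΩ·Ω`, `εΩ′(0)` is `≥ 0`.
[new here — MODEL] -/
theorem trivial_of_nonneg_on_Ioi (cω cl a ε : ℝ) (H U Om dOm ddOm : ℝ → ℝ) (hcl : cl < cω) (hε : 0 ≤ ε) (ha : -1 ≤ a)
    (hU : ∀ ξ, HasDerivAt U (H ξ) ξ) (hOm : ∀ ξ, HasDerivAt Om (dOm ξ) ξ) (hdOm : ∀ ξ, HasDerivAt dOm (ddOm ξ) ξ)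
    (hOm0 : Om 0 = 0) (hF : ∀ ξ ∈ Ioi (0:ℝ), F1 cω cl a 1 ε H U Om dOm ddOm (fun _ => 0) ξ = 0)
    (iOm : IntegrableOn Om (Ioi 0)) (iHOm : IntegrableOn (fun ξ => H ξ * Om ξ) (Ioi 0))
    (iξd : IntegrableOn (fun ξ => ξ * dOm ξ) (Ioi 0)) (iUd : IntegrableOn (fun ξ => U ξ * dOm ξ) (Ioi 0))
    (idd : IntegrableOn ddOm (Ioi 0))
    (hξOm : Tendsto (fun ξ => ξ * Om ξ) atTop (𝓝 0)) (hUOm : Tendsto (fun ξ => U ξ * Om ξ) atTop (𝓝 0))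
    (hdOmInf : Tendsto dOm atTop (𝓝 0))
    (hsign : ∀ ξ ∈ Ioi (0:ℝ), 0 ≤ Om ξ) (hpair : ∫ ξ in Ioi (0:ℝ), H ξ * Om ξ ≤ 0) :
    EqOn Om 0 (Ioi 0) := by
  have hid := halfLine_identity_gCLM cω cl a ε H U Om dOm ddOm hU hOm hdOm hOm0 hF iOm iHOm iξd iUd idd hξOm hUOm hdOmInf
  have hI : 0 ≤ ∫ ξ in Ioi (0:ℝ), Om ξ := setIntegral_nonneg measurableSet_Ioi hsign
  have hd0 : 0 ≤ dOm 0 := deriv_nonneg_of_nonneg_on_Ioi (hOm 0) hOm0 hsign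
  have hT2 : (1 + a) * (∫ ξ in Ioi (0:ℝ), H ξ * Om ξ) ≤ 0 := mul_nonpos_of_nonneg_of_nonpos (by linarith) hpair
  have hT3 : 0 ≤ ε * dOm 0 := mul_nonneg hε hd0
  have hI0 : ∫ ξ in Ioi (0:ℝ), Om ξ = 0 := by
    by_contra hne
    have hpos : 0 < ∫ ξ in Ioi (0:ℝ), Om ξ := lt_of_le_of_ne hI (Ne.symm hne)
    have : 0 < (cω - cl) * ∫ ξ in Ioi (0:ℝ), Om ξ := mul_pos (by linarith) hpos
    linarith
  have hc : ContinuousOn Om (Ioi 0) := fun x _ => (hOm x).continuousAt.continuousWithinAt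
  exact eqOn_zero_of_nonneg_of_integral_eq_zero hc hsign iOm hI0

/-- **SIGN LAW 2: for `a ≤ −1` no blow-up profile is `≤ 0` on `(0,∞)` — the E½ sign class is EMPTY for `a ≤ −1`.**
Same setting as `trivial_of_nonneg_on_Ioi` with `Ω ≤ 0` on `(0,∞)` and `a ≤ −1`: in (★) every term is `≤ 0`
(`−(1+a)∫₀^∞HΩ·Ω = (−(1+a))·(∫₀^∞HΩ·Ω)` is a product of a nonnegative and a nonpositive number), so `∫₀^∞ Ω = 0`.
Census reading (CENSUS-Z3 row Z3-E12⁻, clause (i′)): the printed «`a ≤ −1` EMPTY» (Chen 2020 Thm 1.5, PDE with `Λ^γ`)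
gains a KERNEL (S)-side companion for the E-signed profile class, valid for EVERY `ε ≥ 0` (inviscid included: one-signed
inviscid profiles for `a ≤ −1`, if any, must have `c_l ≥ c_ω`). [new here — MODEL] -/
theorem trivial_of_nonpos_on_Ioi (cω cl a ε : ℝ) (H U Om dOm ddOm : ℝ → ℝ) (hcl : cl < cω) (hε : 0 ≤ ε) (ha : a ≤ -1)
    (hU : ∀ ξ, HasDerivAt U (H ξ) ξ) (hOm : ∀ ξ, HasDerivAt Om (dOm ξ) ξ) (hdOm : ∀ ξ, HasDerivAt dOm (ddOm ξ) ξ)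
    (hOm0 : Om 0 = 0) (hF : ∀ ξ ∈ Ioi (0:ℝ), F1 cω cl a 1 ε H U Om dOm ddOm (fun _ => 0) ξ = 0)
    (iOm : IntegrableOn Om (Ioi 0)) (iHOm : IntegrableOn (fun ξ => H ξ * Om ξ) (Ioi 0))
    (iξd : IntegrableOn (fun ξ => ξ * dOm ξ) (Ioi 0)) (iUd : IntegrableOn (fun ξ => U ξ * dOm ξ) (Ioi 0))
    (idd : IntegrableOn ddOm (Ioi 0))
    (hξOm : Tendsto (fun ξ => ξ * Om ξ) atTop (𝓝 0)) (hUOm : Tendsto (fun ξ => U ξ * Om ξ) atTop (𝓝 0))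
    (hdOmInf : Tendsto dOm atTop (𝓝 0))
    (hsign : ∀ ξ ∈ Ioi (0:ℝ), Om ξ ≤ 0) (hpair : ∫ ξ in Ioi (0:ℝ), H ξ * Om ξ ≤ 0) :
    EqOn Om 0 (Ioi 0) := by
  have hid := halfLine_identity_gCLM cω cl a ε H U Om dOm ddOm hU hOm hdOm hOm0 hF iOm iHOm iξd iUd idd hξOm hUOm hdOmInf
  -- work with −Ω ≥ 0
  have hsign' : ∀ ξ ∈ Ioi (0:ℝ), 0 ≤ -Om ξ := fun ξ hξ => by have := hsign ξ hξ; linarith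
  have hI : 0 ≤ ∫ ξ in Ioi (0:ℝ), -Om ξ := setIntegral_nonneg measurableSet_Ioi hsign'
  have hIneg : ∫ ξ in Ioi (0:ℝ), -Om ξ = -∫ ξ in Ioi (0:ℝ), Om ξ := integral_neg _
  have hd0 : 0 ≤ -dOm 0 :=
    deriv_nonneg_of_nonneg_on_Ioi (f := fun x => -Om x) ((hOm 0).neg) (by simp [hOm0]) hsign'
  have hT2 : 0 ≤ (1 + a) * ∫ ξ in Ioi (0:ℝ), H ξ * Om ξ := mul_nonneg_of_nonpos_of_nonpos (by linarith) hpair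
  have hT3 : ε * dOm 0 ≤ 0 := by nlinarith [mul_nonneg hε hd0]
  have hI0 : ∫ ξ in Ioi (0:ℝ), -Om ξ = 0 := by
    by_contra hne
    have hpos : 0 < ∫ ξ in Ioi (0:ℝ), -Om ξ := lt_of_le_of_ne hI (Ne.symm hne)
    have : 0 < (cω - cl) * ∫ ξ in Ioi (0:ℝ), -Om ξ := mul_pos (by linarith) hpos
    rw [hIneg] at this
    linarith
  have hc : ContinuousOn (fun x => -Om x) (Ioi 0) := fun x _ => ((hOm x).neg).continuousAt.continuousWithinAt
  have hneg : IntegrableOn (fun x => -Om x) (Ioi (0:ℝ)) := iOm.neg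
  have hz := eqOn_zero_of_nonneg_of_integral_eq_zero hc hsign' hneg hI0
  intro x hx
  have := hz hx
  simp only [Pi.zero_apply, neg_eq_zero] at this
  simpa using this

/-- **At `a = −1` (Córdoba–Córdoba–Fontelos) no ONE-SIGNED blow-up profile exists** on `{c_l < c_ω}`, any `ε ≥ 0`
(modulo the pairing sign): both sign laws apply. [new here — MODEL] -/
theorem trivial_of_oneSigned_of_a_eq_neg_one (cω cl ε : ℝ) (H U Om dOm ddOm : ℝ → ℝ) (hcl : cl < cω) (hε : 0 ≤ ε)
    (hU : ∀ ξ, HasDerivAt U (H ξ) ξ) (hOm : ∀ ξ, HasDerivAt Om (dOm ξ) ξ) (hdOm : ∀ ξ, HasDerivAt dOm (ddOm ξ) ξ)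
    (hOm0 : Om 0 = 0) (hF : ∀ ξ ∈ Ioi (0:ℝ), F1 cω cl (-1) 1 ε H U Om dOm ddOm (fun _ => 0) ξ = 0)
    (iOm : IntegrableOn Om (Ioi 0)) (iHOm : IntegrableOn (fun ξ => H ξ * Om ξ) (Ioi 0))
    (iξd : IntegrableOn (fun ξ => ξ * dOm ξ) (Ioi 0)) (iUd : IntegrableOn (fun ξ => U ξ * dOm ξ) (Ioi 0))
    (idd : IntegrableOn ddOm (Ioi 0))
    (hξOm : Tendsto (fun ξ => ξ * Om ξ) atTop (𝓝 0)) (hUOm : Tendsto (fun ξ => U ξ * Om ξ) atTop (𝓝 0))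
    (hdOmInf : Tendsto dOm atTop (𝓝 0))
    (hsign : (∀ ξ ∈ Ioi (0:ℝ), 0 ≤ Om ξ) ∨ (∀ ξ ∈ Ioi (0:ℝ), Om ξ ≤ 0))
    (hpair : ∫ ξ in Ioi (0:ℝ), H ξ * Om ξ ≤ 0) :
    EqOn Om 0 (Ioi 0) := by
  rcases hsign with h | h
  · exact trivial_of_nonneg_on_Ioi cω cl (-1) ε H U Om dOm ddOm hcl hε (by norm_num) hU hOm hdOm hOm0 hF iOm iHOm iξd iUd
      idd hξOm hUOm hdOmInf h hpair
  · exact trivial_of_nonpos_on_Ioi cω cl (-1) ε H U Om dOm ddOm hcl hε (by norm_num) hU hOm hdOm hOm0 hF iOm iHOm iξd iUd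
      idd hξOm hUOm hdOmInf h hpair

/-- From «`Ω = 0` on `(0,∞)`» to «`Ω = 0` on `ℝ`» for an odd profile. [folklore] -/
theorem eq_zero_of_odd_of_eqOn_Ioi {Om : ℝ → ℝ} (hodd : ∀ x, Om (-x) = -Om x) (hz : EqOn Om 0 (Ioi 0)) : Om = 0 := by
  funext x
  rcases lt_trichotomy x 0 with hx | hx | hx
  · have hneg : -x ∈ Ioi (0:ℝ) := by
      simp only [mem_Ioi]
      linarith
    have h := hz hneg
    rw [hodd] at h
    simp only [Pi.zero_apply, neg_eq_zero] at h
    exact h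
  · subst hx
    have h := hodd 0
    simp only [neg_zero] at h
    show Om 0 = 0
    linarith
  · exact hz hx

/-! ### The energy identity on the line and the empty sheet at `a = −2` -/

/-- **THE ENERGY IDENTITY (E) of the frozen-`ε` sheet map** (explicit-hypothesis form; test `F₁` against `Ω` over `ℝ`).
Let `Ω` be `C²` on `ℝ`, `𝒰′ = H`, `F₁ ≡ 0` on `ℝ`; if `Ω², HΩ·Ω², ξΩΩ′, 𝒰ΩΩ′, ΩΩ″, Ω′², PΩ` are integrable and
`ξΩ² → 0`, `𝒰Ω² → 0`, `ΩΩ′ → 0` at `±∞`, then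
`(c_ω − c_l/2)∫Ω² − (b + a/2)∫HΩ·Ω² − ∫PΩ + ε∫Ω′² = 0`.
(By parts: `∫ξΩΩ′ = −½∫Ω²`, `∫𝒰ΩΩ′ = −½∫HΩ·Ω²`, `−∫ΩΩ″ = ∫Ω′²`.) This is SHEET §1.6's energy identity (engine null);
`b = 1`, `P = 0` is the gCLM/OSW sheet. [new here — MODEL] -/
theorem energy_identity (cω cl a b ε : ℝ) (H U Om dOm ddOm P : ℝ → ℝ)
    (hU : ∀ ξ, HasDerivAt U (H ξ) ξ) (hOm : ∀ ξ, HasDerivAt Om (dOm ξ) ξ) (hdOm : ∀ ξ, HasDerivAt dOm (ddOm ξ) ξ)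
    (hF : ∀ ξ, F1 cω cl a b ε H U Om dOm ddOm P ξ = 0)
    (i1 : Integrable fun ξ => Om ξ ^ 2) (i2 : Integrable fun ξ => H ξ * Om ξ ^ 2)
    (i3 : Integrable fun ξ => ξ * (Om ξ * dOm ξ)) (i4 : Integrable fun ξ => U ξ * (Om ξ * dOm ξ))
    (i5 : Integrable fun ξ => Om ξ * ddOm ξ) (i6 : Integrable fun ξ => dOm ξ ^ 2) (i7 : Integrable fun ξ => P ξ * Om ξ)
    (hb1 : Tendsto (fun ξ => ξ * Om ξ ^ 2) atBot (𝓝 0)) (ht1 : Tendsto (fun ξ => ξ * Om ξ ^ 2) atTop (𝓝 0))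
    (hb2 : Tendsto (fun ξ => U ξ * Om ξ ^ 2) atBot (𝓝 0)) (ht2 : Tendsto (fun ξ => U ξ * Om ξ ^ 2) atTop (𝓝 0))
    (hb3 : Tendsto (fun ξ => Om ξ * dOm ξ) atBot (𝓝 0)) (ht3 : Tendsto (fun ξ => Om ξ * dOm ξ) atTop (𝓝 0)) :
    (cω - cl / 2) * (∫ ξ, Om ξ ^ 2) - (b + a / 2) * (∫ ξ, H ξ * Om ξ ^ 2) - (∫ ξ, P ξ * Om ξ)
      + ε * (∫ ξ, dOm ξ ^ 2) = 0 := by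
  -- (i) ∫ (Ω² + 2ξΩΩ′) = 0
  have h1 : ∫ ξ, (Om ξ ^ 2 + 2 * (ξ * (Om ξ * dOm ξ))) = 0 := by
    have hd : ∀ ξ, HasDerivAt (fun x => x * Om x ^ 2) (Om ξ ^ 2 + 2 * (ξ * (Om ξ * dOm ξ))) ξ := by
      intro ξ
      have h := (hasDerivAt_id' ξ).mul ((hOm ξ).pow 2)
      refine h.congr_deriv ?_
      simp only [Pi.pow_apply, Nat.cast_ofNat, Nat.reduceSub, pow_one, one_mul]
      ring
    have hi : Integrable fun ξ => Om ξ ^ 2 + 2 * (ξ * (Om ξ * dOm ξ)) := i1.add (i3.const_mul 2)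
    have h := integral_of_hasDerivAt_of_tendsto hd hi hb1 ht1
    simpa using h
  -- (ii) ∫ (HΩ·Ω² + 2𝒰ΩΩ′) = 0
  have h2 : ∫ ξ, (H ξ * Om ξ ^ 2 + 2 * (U ξ * (Om ξ * dOm ξ))) = 0 := by
    have hd : ∀ ξ, HasDerivAt (fun x => U x * Om x ^ 2) (H ξ * Om ξ ^ 2 + 2 * (U ξ * (Om ξ * dOm ξ))) ξ := by
      intro ξ
      have h := (hU ξ).mul ((hOm ξ).pow 2)
      refine h.congr_deriv ?_
      simp only [Pi.pow_apply, Nat.cast_ofNat, Nat.reduceSub, pow_one]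
      ring
    have hi : Integrable fun ξ => H ξ * Om ξ ^ 2 + 2 * (U ξ * (Om ξ * dOm ξ)) := i2.add (i4.const_mul 2)
    have h := integral_of_hasDerivAt_of_tendsto hd hi hb2 ht2
    simpa using h
  -- (iii) ∫ (Ω′² + ΩΩ″) = 0
  have h3 : ∫ ξ, (dOm ξ ^ 2 + Om ξ * ddOm ξ) = 0 := by
    have hd : ∀ ξ, HasDerivAt (fun x => Om x * dOm x) (dOm ξ ^ 2 + Om ξ * ddOm ξ) ξ := by
      intro ξ
      have h := (hOm ξ).mul (hdOm ξ)
      refine h.congr_deriv ?_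
      ring
    have hi : Integrable fun ξ => dOm ξ ^ 2 + Om ξ * ddOm ξ := i6.add i5
    have h := integral_of_hasDerivAt_of_tendsto hd hi hb3 ht3
    simpa using h
  -- integrate F₁·Ω ≡ 0 over ℝ after regrouping
  have key : ∫ ξ, F1 cω cl a b ε H U Om dOm ddOm P ξ * Om ξ = 0 := by
    simp [hF]
  have hre : ∀ ξ, F1 cω cl a b ε H U Om dOm ddOm P ξ * Om ξ =
      ((cω - cl / 2) * Om ξ ^ 2 + cl / 2 * (Om ξ ^ 2 + 2 * (ξ * (Om ξ * dOm ξ)))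
          + a / 2 * (H ξ * Om ξ ^ 2 + 2 * (U ξ * (Om ξ * dOm ξ))) + ε * dOm ξ ^ 2)
        - ((b + a / 2) * (H ξ * Om ξ ^ 2) + P ξ * Om ξ + ε * (dOm ξ ^ 2 + Om ξ * ddOm ξ)) := by
    intro ξ
    unfold HouLuoOriginLaws.F1
    ring
  have iA1 : Integrable fun ξ => (cω - cl / 2) * Om ξ ^ 2 := i1.const_mul _
  have iA2 : Integrable fun ξ => cl / 2 * (Om ξ ^ 2 + 2 * (ξ * (Om ξ * dOm ξ))) := (i1.add (i3.const_mul 2)).const_mul _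
  have iA3 : Integrable fun ξ => a / 2 * (H ξ * Om ξ ^ 2 + 2 * (U ξ * (Om ξ * dOm ξ))) :=
    (i2.add (i4.const_mul 2)).const_mul _
  have iA4 : Integrable fun ξ => ε * dOm ξ ^ 2 := i6.const_mul _
  have iA12 : Integrable fun ξ => (cω - cl / 2) * Om ξ ^ 2 + cl / 2 * (Om ξ ^ 2 + 2 * (ξ * (Om ξ * dOm ξ))) :=
    iA1.add iA2
  have iA123 : Integrable fun ξ => (cω - cl / 2) * Om ξ ^ 2 + cl / 2 * (Om ξ ^ 2 + 2 * (ξ * (Om ξ * dOm ξ)))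
      + a / 2 * (H ξ * Om ξ ^ 2 + 2 * (U ξ * (Om ξ * dOm ξ))) := iA12.add iA3
  have iA : Integrable fun ξ => (cω - cl / 2) * Om ξ ^ 2 + cl / 2 * (Om ξ ^ 2 + 2 * (ξ * (Om ξ * dOm ξ)))
      + a / 2 * (H ξ * Om ξ ^ 2 + 2 * (U ξ * (Om ξ * dOm ξ))) + ε * dOm ξ ^ 2 := iA123.add iA4
  have iB1 : Integrable fun ξ => (b + a / 2) * (H ξ * Om ξ ^ 2) := i2.const_mul _
  have iB3 : Integrable fun ξ => ε * (dOm ξ ^ 2 + Om ξ * ddOm ξ) := (i6.add i5).const_mul _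
  have iB12 : Integrable fun ξ => (b + a / 2) * (H ξ * Om ξ ^ 2) + P ξ * Om ξ := iB1.add i7
  have iB : Integrable fun ξ => (b + a / 2) * (H ξ * Om ξ ^ 2) + P ξ * Om ξ + ε * (dOm ξ ^ 2 + Om ξ * ddOm ξ) :=
    iB12.add iB3
  simp_rw [hre] at key
  rw [integral_sub iA iB, integral_add iA123 iA4, integral_add iA12 iA3, integral_add iA1 iA2, integral_add iB12 iB3,
    integral_add iB1 i7, integral_const_mul, integral_const_mul, integral_const_mul, integral_const_mul,
    integral_const_mul, integral_const_mul, h1, h2, h3] at key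
  linear_combination key

/-- **At `a = −2` the gCLM/OSW sheet `{c_l < 2c_ω}` is EMPTY for every `ε ≥ 0`** (any sign structure; no pairing sign needed):
with `b = 1`, `P = 0` the cubic term of (E) has coefficient `b + a/2 = 0`, so `(c_ω − c_l/2)∫Ω² + ε∫Ω′² = 0` forces
`∫Ω² = 0`, i.e. `Ω ≡ 0` for a continuous `Ω`. (The pen corollary left open by profile-eng-3 g5, SHEET §13 item (5); the PDE at
`a = −2 ≤ −1` is globally well-posed in print, Chen 2020 Thm 1.5 — cited, not restated.) [new here — MODEL] -/
theorem trivial_of_a_eq_neg_two (cω cl ε : ℝ) (H U Om dOm ddOm : ℝ → ℝ) (hcl : cl < 2 * cω) (hε : 0 ≤ ε)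
    (hU : ∀ ξ, HasDerivAt U (H ξ) ξ) (hOm : ∀ ξ, HasDerivAt Om (dOm ξ) ξ) (hdOm : ∀ ξ, HasDerivAt dOm (ddOm ξ) ξ)
    (hF : ∀ ξ, F1 cω cl (-2) 1 ε H U Om dOm ddOm (fun _ => 0) ξ = 0)
    (i1 : Integrable fun ξ => Om ξ ^ 2) (i2 : Integrable fun ξ => H ξ * Om ξ ^ 2)
    (i3 : Integrable fun ξ => ξ * (Om ξ * dOm ξ)) (i4 : Integrable fun ξ => U ξ * (Om ξ * dOm ξ))
    (i5 : Integrable fun ξ => Om ξ * ddOm ξ) (i6 : Integrable fun ξ => dOm ξ ^ 2)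
    (hb1 : Tendsto (fun ξ => ξ * Om ξ ^ 2) atBot (𝓝 0)) (ht1 : Tendsto (fun ξ => ξ * Om ξ ^ 2) atTop (𝓝 0))
    (hb2 : Tendsto (fun ξ => U ξ * Om ξ ^ 2) atBot (𝓝 0)) (ht2 : Tendsto (fun ξ => U ξ * Om ξ ^ 2) atTop (𝓝 0))
    (hb3 : Tendsto (fun ξ => Om ξ * dOm ξ) atBot (𝓝 0)) (ht3 : Tendsto (fun ξ => Om ξ * dOm ξ) atTop (𝓝 0)) :
    Om = 0 := by
  have i7 : Integrable fun ξ => (fun _ : ℝ => (0:ℝ)) ξ * Om ξ := by simp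
  have hid := energy_identity cω cl (-2) 1 ε H U Om dOm ddOm (fun _ => 0) hU hOm hdOm hF i1 i2 i3 i4 i5 i6 i7
    hb1 ht1 hb2 ht2 hb3 ht3
  have hid' : (cω - cl / 2) * (∫ ξ, Om ξ ^ 2) + ε * (∫ ξ, dOm ξ ^ 2) = 0 := by
    norm_num at hid
    linear_combination hid
  have hA : 0 ≤ ∫ ξ, Om ξ ^ 2 := integral_nonneg fun ξ => sq_nonneg _
  have hB : 0 ≤ ∫ ξ, dOm ξ ^ 2 := integral_nonneg fun ξ => sq_nonneg _
  have hcoef : 0 < cω - cl / 2 := by linarith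
  have hI0 : ∫ ξ, Om ξ ^ 2 = 0 := by
    by_contra hne
    have hpos : 0 < ∫ ξ, Om ξ ^ 2 := lt_of_le_of_ne hA (Ne.symm hne)
    have h1 : 0 < (cω - cl / 2) * ∫ ξ, Om ξ ^ 2 := mul_pos hcoef hpos
    have h2 : 0 ≤ ε * ∫ ξ, dOm ξ ^ 2 := mul_nonneg hε hB
    linarith
  have hcont : Continuous Om := continuous_iff_continuousAt.mpr fun x => (hOm x).continuousAt
  have hae : (fun ξ => Om ξ ^ 2) =ᵐ[volume] 0 :=
    (integral_eq_zero_iff_of_nonneg (fun ξ => sq_nonneg _) i1).mp hI0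
  have hsq : (fun ξ => Om ξ ^ 2) = 0 :=
    (Continuous.ae_eq_iff_eq volume (hcont.pow 2) continuous_const).mp hae
  funext x
  simpa using congrFun hsq x

end SheetHalfLine
end Summit.NavierStokesRegularity.OSWSelfSimilar
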